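import Summits.HodgeConjecture.CorCM.GaloisNormalSylowThirtyTwo
import HarnessLib

/-!
# THE STRUCTURE OF GOOD GALOIS CM FIELDS OF DEGREE DIVISIBLE BY `32` — no size hypothesis: `[K:ℚ] = 2ⁿ` with
# `Gal ∈ {C, Q, C × C₂, Q × C₂}`, or `[K:ℚ] = 2ⁿ·p` with `Gal = C_p ⋊ C_{2ⁿ}` or `C_p ⋊ Q_{2ⁿ}` (five shapes), `n ≥ 5`

COR-CM (cell `pub-hodgecm2`), binder seat b04 (gen 39), count-neutral own lane «Galois-CM-type classification».  KERNEL ONLY: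
theorems; no definition, no named fact, no `sorry`.  `HC_CM` is neither used nor claimed.

Gen 38's `CorCM/GaloisLargeDegreeStructure` proved the structure theorem for GOOD Galois CM fields (all primitive CM types nondegenerate)
from `64 ∣ [K:ℚ]` with no further hypothesis, and from `32 ∣ [K:ℚ]` under gen 33's size condition at the odd primes `< 31`.  The refined
skew-section count of gen 39 (`CorCM/GaloisSkewSectionPrimeOrbits` … `CorCM/GaloisNormalSylowThirtyTwo`: for `32 ∣ [K:ℚ]` the Sylow
`p`-subgroups of a GOOD field are normal of order `≤ p` for EVERY odd prime `p`) removes the size condition at `n = 5`: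

**`structure_of_forall_isNondegenerate_of_thirtytwo_dvd`.**  `[K:ℚ] = 2ⁿ·M`, `M` odd, `n ≥ 5`, `K` GOOD ⟹ EITHER `M = 1` and
`Gal(K/ℚ) = H·E` (`E` central of exponent `2`, `|E| ≤ 2`, `c ∈ H ∖ E`, `H` cyclic or generalised quaternion — gen 37), OR `M = p` is
prime, complex conjugation is the unique involution, and `Gal(K/ℚ) = ⟨u⟩ ⋊ S` with `S` a Sylow `2`-subgroup (order `2ⁿ`) either cyclic
`⟨x⟩` (`x u x⁻¹ = uʳ`: shape C(r)) or generalised quaternion `⟨a, x⟩` acting through `±1` in one of the three ways Q×, Dic, QK (gen 38's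
parametrised shape theorems `shape_of_isCyclic_sylow_of_normal_prime`, `shape_of_quaternion_sylow_of_normal_prime`).

* §1 `odd_part_eq_one_or_prime_of_thirtytwo_dvd` (the odd part of `[K:ℚ]` is `1` or a prime; gen 38's `odd_part_eq_one_or_prime'`
  with `sylow_normal_and_le_one_of_thirtytwo_dvd` in place of the size condition), `exists_normal_prime_of_thirtytwo_dvd`.
* §2 **`structure_of_forall_isNondegenerate_of_thirtytwo_dvd`**, `involution_eq_complexConj_of_thirtytwo_dvd`.
* §3 BAD corollaries from `32 ∣ [K:ℚ]`: odd part not in `{1} ∪ primes`; an involution `≠ c` next to an odd prime; a Sylow `2`-subgroup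
  neither cyclic nor generalised quaternion next to an odd prime — each yields a simple degenerate CM abelian variety of dimension
  `[K:ℚ]/2` with an exceptional Hodge class on some power.

What is left below: `n = 4` (`[K:ℚ] = 16·M`; the GOOD `2`-parts are then `C₁₆, Q₁₆, C₈×C₂, Q₈×C₂, D₄×C₂, C₄×C₂², …` of the order-`16`
census and the odd-prime analysis changes) and small indices; and, in every degree, the arithmetic of the shapes C(r) (residue classes),
Q×, QK.

## References

* [Shimura1998] G. Shimura, *Abelian Varieties with Complex Multiplication and Modular Functions*, §6.2 Thm. 3, §8.2 Prop. 26, §32.10.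
* [Gordon1999HodgeAVSurvey] B. B. Gordon, *A survey of the Hodge conjecture for abelian varieties*, Thm. 6.4, §9.3.
* [Dodson1984] B. Dodson, *The structure of Galois groups of CM-fields*, Trans. AMS 283 (1984), §3.1.1, §4.1, §5.
* [Rotman1995] J. J. Rotman, *An Introduction to the Theory of Groups*, 4th ed., GTM 148, Thm. 4.12, Thm. 5.46, Thm. 7.41.
-/

noncomputable section

open CategoryTheory CategoryTheory.Limits NumberField
open scoped BigOperators

namespace Summit.HodgeConjecture.CorCM.GaloisModels

open Literature.NumberTheory.ComplexMultiplication Literature.AlgebraicGeometry.HodgeTheory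
open Literature.AlgebraicGeometry.Motives (AbelianVariety CMType)
open Literature.AlgebraicGeometry.ComplexMultiplication (IsCMTypeRealisation)
open Literature.AlgebraicGeometry.Pohlmann1968 Summit.HodgeConjecture.CorCM.GaloisRank
open Literature.Barriers.HodgeConjecture (divisorClassesSpan)

variable {K : Type} [Field K] [NumberField K] [IsCMField K] [IsGalois ℚ K]

/-! ## §1 The odd part of the degree is `1` or a prime -/

/-- **`[K:ℚ] = 2ⁿ·M`, `M` odd, `n ≥ 5`, `K` GOOD ⟹ `M = 1` or `M` is prime** — no size hypothesis (gen 38's `odd_part_eq_one_or_prime'`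
needed gen 33's size condition at the odd primes `< 31`). [cite: Shimura1998, §8.2 Prop. 26 and §32.10] [cite: Dodson1984, §3.1.1, §4.1 and §5]
[cite: Rotman1995, Thm. 4.12 and Thm. 7.41] -/
theorem odd_part_eq_one_or_prime_of_thirtytwo_dvd {n M : ℕ} (hdeg : Module.finrank ℚ K = 2 ^ n * M) (hM : Odd M) (hn : 5 ≤ n)
    (hgood : ∀ (Φ : CMType K) (φ : K →+* ℂ), IsPrimitive (ℂ ≃+* ℂ) Φ.1 φ → IsNondegenerate Φ) : M = 1 ∨ M.Prime := by
  classical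
  by_cases hM1 : M = 1
  · exact Or.inl hM1
  right
  -- the least prime factor `p` of `M`
  set p := M.minFac with hp_def
  have hpp : p.Prime := Nat.minFac_prime hM1
  haveI : Fact p.Prime := ⟨hpp⟩
  have hpM : p ∣ M := Nat.minFac_dvd M
  have hp2 : p ≠ 2 := by
    rintro h
    rw [h] at hpM
    exact (Nat.not_even_iff_odd.2 hM) (even_iff_two_dvd.2 hpM)
  obtain ⟨a, M₁, hMa, ha, hpM₁, hM₁⟩ := exists_eq_pow_mul_of_dvd hM hpp hpM
  obtain ⟨n', rfl⟩ := Nat.exists_eq_add_of_le hn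
  have h2pow : (2 : ℕ) ^ (5 + n') = 2 * (16 * 2 ^ n') := by rw [pow_add]; ring
  -- `a = 1`
  have hdegp : Module.finrank ℚ K = 2 * p ^ a * (16 * 2 ^ n' * M₁) := by rw [hdeg, hMa, h2pow]; ring
  have hpm : ¬ p ∣ 16 * 2 ^ n' * M₁ := fun h => by
    rcases (Nat.Prime.dvd_mul hpp).1 h with h | h
    · have : p ∣ 2 ^ (4 + n') := by rw [pow_add]; exact h
      exact hp2 ((Nat.prime_dvd_prime_iff_eq hpp Nat.prime_two).1 (hpp.dvd_of_dvd_pow this))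
    · exact hpM₁ h
  have h16 : 16 ∣ 16 * 2 ^ n' * M₁ := ⟨2 ^ n' * M₁, by ring⟩
  obtain ⟨hPn, ha1⟩ := sylow_normal_and_le_one_of_thirtytwo_dvd hp2 hdegp hpm h16 hgood
  have ha' : a = 1 := le_antisymm ha1 ha
  subst ha'
  rw [pow_one] at hMa
  -- no second prime factor
  by_contra hMp
  have hM₁1 : M₁ ≠ 1 := by
    rintro rfl
    rw [mul_one] at hMa
    exact hMp (hMa ▸ hpp)
  set q := M₁.minFac with hq_def
  have hqq : q.Prime := Nat.minFac_prime hM₁1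
  haveI : Fact q.Prime := ⟨hqq⟩
  have hqM₁ : q ∣ M₁ := Nat.minFac_dvd M₁
  have hq2 : q ≠ 2 := by
    rintro h
    rw [h] at hqM₁
    exact (Nat.not_even_iff_odd.2 hM₁) (even_iff_two_dvd.2 hqM₁)
  have hpq : p ≠ q := fun h => hpM₁ (h ▸ hqM₁)
  obtain ⟨b, M₂, hMb, hb, hqM₂, hM₂⟩ := exists_eq_pow_mul_of_dvd hM₁ hqq hqM₁
  have hpM₂ : ¬ p ∣ M₂ := fun h => hpM₁ (hMb ▸ h.mul_left _)
  -- the Sylow `q`-subgroups are normal too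
  have hdegq : Module.finrank ℚ K = 2 * q ^ b * (16 * 2 ^ n' * (p * M₂)) := by rw [hdeg, hMa, hMb, h2pow]; ring
  have hqm : ¬ q ∣ 16 * 2 ^ n' * (p * M₂) := fun h => by
    rcases (Nat.Prime.dvd_mul hqq).1 h with h | h
    · have : q ∣ 2 ^ (4 + n') := by rw [pow_add]; exact h
      exact hq2 ((Nat.prime_dvd_prime_iff_eq hqq Nat.prime_two).1 (hqq.dvd_of_dvd_pow this))
    · rcases (Nat.Prime.dvd_mul hqq).1 h with h | h
      · exact hpq ((Nat.prime_dvd_prime_iff_eq hqq hpp).1 h).symm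
      · exact hqM₂ h
  have h16' : 16 ∣ 16 * 2 ^ n' * (p * M₂) := ⟨2 ^ n' * (p * M₂), by ring⟩
  obtain ⟨hQn, -⟩ := sylow_normal_and_le_one_of_thirtytwo_dvd hq2 hdegq hqm h16' hgood
  -- two non-trivial normal Sylow subgroups of index `2ⁿ M₂ ≥ 32`: BAD
  have hM₂0 : 0 < M₂ := Nat.pos_of_ne_zero (by rintro rfl; exact absurd hM₂ (by decide))
  have hdeg2 : Module.finrank ℚ K = p ^ 1 * q ^ b * (2 ^ (5 + n') * M₂) := by rw [hdeg, hMa, hMb]; ring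
  have hpr : ¬ p ∣ 2 ^ (5 + n') * M₂ := fun h => by
    rcases (Nat.Prime.dvd_mul hpp).1 h with h | h
    · exact hp2 ((Nat.prime_dvd_prime_iff_eq hpp Nat.prime_two).1 (hpp.dvd_of_dvd_pow h))
    · exact hpM₂ h
  have hqr : ¬ q ∣ 2 ^ (5 + n') * M₂ := fun h => by
    rcases (Nat.Prime.dvd_mul hqq).1 h with h | h
    · exact hq2 ((Nat.prime_dvd_prime_iff_eq hqq Nat.prime_two).1 (hqq.dvd_of_dvd_pow h))
    · exact hqM₂ h
  have h14 : 14 ≤ 2 ^ (5 + n') * M₂ := by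
    have h32 : 32 ≤ 2 ^ (5 + n') := by
      rw [pow_add]
      have := Nat.one_le_two_pow (n := n')
      calc (32 : ℕ) = 2 ^ 5 * 1 := by norm_num
        _ ≤ 2 ^ 5 * 2 ^ n' := Nat.mul_le_mul_left _ this
    calc (14 : ℕ) ≤ 32 * 1 := by norm_num
      _ ≤ 2 ^ (5 + n') * M₂ := Nat.mul_le_mul h32 hM₂0
  obtain ⟨Φ, φ, X, ι, ϑ, H1, H2, -⟩ :=
    exists_simple_degenerate_of_two_primes_of_sylow_normal hp2 hq2 hpq hdeg2 hpr hqr le_rfl hb h14 hPn hQn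
  exact H2 (hgood Φ φ H1)

/-- **`[K:ℚ] = 2ⁿ·p`, `p` an odd prime, `n ≥ 5`, `K` GOOD ⟹ a NORMAL subgroup of order `p`** (the Sylow `p`-subgroup).
[cite: Rotman1995, Thm. 4.12] [cite: Shimura1998, §8.2 Prop. 26 and §32.10] -/
theorem exists_normal_prime_of_thirtytwo_dvd {n p : ℕ} [hp : Fact p.Prime] (hp2 : p ≠ 2) (hdeg : Module.finrank ℚ K = 2 ^ n * p)
    (hn : 5 ≤ n) (hgood : ∀ (Φ : CMType K) (φ : K →+* ℂ), IsPrimitive (ℂ ≃+* ℂ) Φ.1 φ → IsNondegenerate Φ) :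
    ∃ P : Subgroup (K ≃ₐ[ℚ] K), P.Normal ∧ Nat.card P = p := by
  classical
  have hpp := hp.out
  obtain ⟨Q⟩ := (inferInstance : Nonempty (Sylow p (K ≃ₐ[ℚ] K)))
  have hdeg' : Module.finrank ℚ K = p ^ 1 * 2 ^ n := by rw [hdeg]; ring
  have hpr : ¬ p ∣ 2 ^ n := fun h => hp2 ((Nat.prime_dvd_prime_iff_eq hpp Nat.prime_two).1 (hpp.dvd_of_dvd_pow h))
  obtain ⟨hcardQ, -⟩ := card_sylow_eq_of_finrank hdeg' hpr Q
  rw [pow_one] at hcardQ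
  have h32 : 32 ∣ Module.finrank ℚ K := by
    rw [hdeg]
    obtain ⟨n', rfl⟩ := Nat.exists_eq_add_of_le hn
    exact Dvd.dvd.mul_right (by rw [pow_add]; exact Dvd.intro _ rfl) p
  exact ⟨Q, sylow_normal_of_forall_isNondegenerate_of_thirtytwo_dvd p hp2 h32 hgood Q, hcardQ⟩

/-! ## §2 The structure theorem from `32 ∣ [K:ℚ]` -/

/-- **THE STRUCTURE OF A GOOD GALOIS CM FIELD OF DEGREE DIVISIBLE BY `32` — no size hypothesis.**  `[K:ℚ] = 2ⁿ·M` with `M` odd and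
`n ≥ 5`; `K` GOOD ⟹ EITHER `M = 1` and `Gal(K/ℚ) = H·E` (`E` central of exponent `2`, `|E| ≤ 2`, `c ∈ H ∖ E`, `H` cyclic or generalised
quaternion), OR `M` is prime, `c` is the unique involution of `Gal(K/ℚ)`, and `Gal(K/ℚ) = ⟨u⟩ ⋊ S` (`u` of order `M` generating a
normal subgroup, `S` any Sylow `2`-subgroup, of order `2ⁿ`) with `S = ⟨x⟩` cyclic and `x u x⁻¹ = uʳ`, or `S = ⟨a, x⟩` generalised
quaternion (`x a = a⁻¹ x`, `x² = a^{2ⁿ⁻²}`, `a` of order `2ⁿ⁻¹`) acting by `(a, x) ↦ (1, 1)`, `(1, −1)` or `(−1, 1)` on `u`.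
[cite: Shimura1998, §8.2 Prop. 26 and §32.10] [cite: Dodson1984, §3.1.1, §4.1 and §5] [cite: Rotman1995, Thm. 4.12, Thm. 5.46 and Thm. 7.41] -/
theorem structure_of_forall_isNondegenerate_of_thirtytwo_dvd {n M : ℕ} (hdeg : Module.finrank ℚ K = 2 ^ n * M) (hM : Odd M)
    (hn : 5 ≤ n) (hgood : ∀ (Φ : CMType K) (φ : K →+* ℂ), IsPrimitive (ℂ ≃+* ℂ) Φ.1 φ → IsNondegenerate Φ) [Fact (Nat.Prime 2)] :
    (M = 1 ∧ ∃ (H E : Subgroup (K ≃ₐ[ℚ] K)) (k : ℕ), H.IsComplement' E ∧ (IsCMField.complexConj K).restrictScalars ℚ ∈ H ∧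
      (IsCMField.complexConj K).restrictScalars ℚ ∉ E ∧ (∀ e ∈ E, e * e = 1 ∧ ∀ g : K ≃ₐ[ℚ] K, g * e = e * g) ∧
      Nat.card E ≤ 2 ∧ Nat.card H = 2 ^ k ∧ (IsCyclic H ∨ (3 ≤ k ∧ Nonempty (H ≃* QuaternionGroup (2 ^ (k - 2)))))) ∨
    (M.Prime ∧ (∀ σ : K ≃ₐ[ℚ] K, σ * σ = 1 → σ ≠ 1 → σ = (IsCMField.complexConj K).restrictScalars ℚ) ∧
      ∀ S : Sylow 2 (K ≃ₐ[ℚ] K), Nat.card (S : Subgroup (K ≃ₐ[ℚ] K)) = 2 ^ n ∧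
        ((∃ u x : K ≃ₐ[ℚ] K, orderOf u = M ∧ (Subgroup.zpowers u).Normal ∧ orderOf x = 2 ^ n ∧
            Subgroup.zpowers x = (S : Subgroup (K ≃ₐ[ℚ] K)) ∧ (∀ g : K ≃ₐ[ℚ] K, ∃ j i : ℕ, g = u ^ j * x ^ i) ∧
            ∃ r : ℕ, x * u * x⁻¹ = u ^ r) ∨
         (∃ u a x : K ≃ₐ[ℚ] K, orderOf u = M ∧ (Subgroup.zpowers u).Normal ∧ orderOf a = 2 ^ (n - 1) ∧
            a ∈ (S : Subgroup (K ≃ₐ[ℚ] K)) ∧ x ∈ (S : Subgroup (K ≃ₐ[ℚ] K)) ∧ x ∉ Subgroup.zpowers a ∧ x * a = a⁻¹ * x ∧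
            x * x = a ^ 2 ^ (n - 2) ∧ (∀ g : K ≃ₐ[ℚ] K, ∃ j i : ℕ, g = u ^ j * a ^ i ∨ g = u ^ j * (x * a ^ i)) ∧
            ((a * u * a⁻¹ = u ∧ x * u * x⁻¹ = u) ∨ (a * u * a⁻¹ = u ∧ x * u * x⁻¹ = u⁻¹) ∨
              (a * u * a⁻¹ = u⁻¹ ∧ x * u * x⁻¹ = u))))) := by
  classical
  by_cases hM1 : M = 1
  · subst hM1
    rw [mul_one] at hdeg
    exact Or.inl ⟨rfl, struct_two_power hdeg hn hgood⟩
  · have hMp : M.Prime := (odd_part_eq_one_or_prime_of_thirtytwo_dvd hdeg hM hn hgood).resolve_left hM1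
    haveI : Fact M.Prime := ⟨hMp⟩
    have hM2 : M ≠ 2 := by
      rintro rfl
      exact (Nat.not_even_iff_odd.2 hM) even_two
    obtain ⟨P, hPn, hcardP⟩ := exists_normal_prime_of_thirtytwo_dvd hM2 hdeg hn hgood
    haveI := hPn
    refine Or.inr ⟨hMp, fun σ hσσ hσ1 => involution_eq_complexConj_of_normal_prime hM2 hdeg hn P hcardP hgood σ hσσ hσ1, fun S => ?_⟩
    obtain ⟨hcardS, hS⟩ := sylow_two_isCyclic_or_quaternion_of_normal_prime hM2 hdeg hn P hcardP hgood S
    refine ⟨hcardS, ?_⟩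
    rcases hS with hcyc | ⟨⟨f⟩⟩
    · exact Or.inl (shape_of_isCyclic_sylow_of_normal_prime hM2 hdeg hn P hcardP hgood S hcyc).2
    · exact Or.inr (shape_of_quaternion_sylow_of_normal_prime hM2 hdeg hn P hcardP hgood S f).2

/-- **`c` is the unique involution when an odd prime divides the degree** (`[K:ℚ] = 2ⁿ·M`, `M ≠ 1` odd, `n ≥ 5`; no size hypothesis).
[cite: Shimura1998, §8.2 Prop. 26 and §32.10] [cite: Dodson1984, §5] [cite: Rotman1995, Thm. 5.46] -/
theorem involution_eq_complexConj_of_thirtytwo_dvd {n M : ℕ} (hdeg : Module.finrank ℚ K = 2 ^ n * M) (hM : Odd M) (hn : 5 ≤ n)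
    (hM1 : M ≠ 1) (hgood : ∀ (Φ : CMType K) (φ : K →+* ℂ), IsPrimitive (ℂ ≃+* ℂ) Φ.1 φ → IsNondegenerate Φ)
    (σ : K ≃ₐ[ℚ] K) (hσσ : σ * σ = 1) (hσ1 : σ ≠ 1) : σ = (IsCMField.complexConj K).restrictScalars ℚ := by
  classical
  haveI : Fact (Nat.Prime 2) := ⟨Nat.prime_two⟩
  rcases structure_of_forall_isNondegenerate_of_thirtytwo_dvd hdeg hM hn hgood with ⟨h1, -⟩ | ⟨-, hinv, -⟩
  · exact absurd h1 hM1
  · exact hinv σ hσσ hσ1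

/-! ## §3 BAD corollaries from `32 ∣ [K:ℚ]` -/

/-- **`32 ∣ [K:ℚ]` and the odd part of `[K:ℚ]` neither `1` nor a prime ⟹ BAD**: `K` carries a SIMPLE DEGENERATE abelian variety of
dimension `[K:ℚ]/2` with a rational `(q,q)` class outside the divisor ring on some power. [cite: Shimura1998, §6.2 Thm. 3 and §8.2 Prop. 26]
[cite: Gordon1999HodgeAVSurvey, Thm. 6.4 and §9.3] [cite: Dodson1984, §3.1.1, §4.1 and §5] -/
theorem exists_simple_degenerate_of_odd_part_of_thirtytwo_dvd {n M : ℕ} (hdeg : Module.finrank ℚ K = 2 ^ n * M) (hM : Odd M)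
    (hn : 5 ≤ n) (hM1 : M ≠ 1) (hMp : ¬ M.Prime) :
    ∃ (Φ : CMType K) (φ : K →+* ℂ) (X : AbelianVariety ℂ) (ι : 𝓞 K →+* End X)
      (ϑ : K →+* Module.End ℂ (complexBetti X.X 1)),
      IsPrimitive (ℂ ≃+* ℂ) Φ.1 φ ∧ ¬ IsNondegenerate Φ ∧ IsCMTypeRealisation Φ X ι ϑ ∧ X.IsSimple ∧
      X.dim = Module.finrank ℚ K / 2 ∧
      ∃ n p : ℕ, ∃ x : complexBetti (⨁ fun _ : Fin n => X).X (2 * p), IsRationalClass x ∧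
        IsOfHodgeType (⨁ fun _ : Fin n => X).dim (⨁ fun _ : Fin n => X).X (2 * p) p p x ∧
        x ∉ divisorClassesSpan (⨁ fun _ : Fin n => X).X (⨁ fun _ : Fin n => X).dim p :=
  exists_simple_degenerate_of_not_forall_isNondegenerate fun hgood => by
    rcases odd_part_eq_one_or_prime_of_thirtytwo_dvd hdeg hM hn hgood with h | h
    · exact hM1 h
    · exact hMp h

/-- **`32·p ∣ [K:ℚ] = 2ⁿ·M` (`M ≠ 1` odd, `n ≥ 5`) and an involution `σ ≠ c` of `Gal(K/ℚ)` ⟹ BAD.** [cite: Shimura1998, §6.2 Thm. 3 and §8.2 Prop. 26]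
[cite: Gordon1999HodgeAVSurvey, Thm. 6.4 and §9.3] [cite: Dodson1984, §3.1.1, §4.1 and §5] -/
theorem exists_simple_degenerate_of_involution_ne_of_thirtytwo_dvd {n M : ℕ} (hdeg : Module.finrank ℚ K = 2 ^ n * M) (hM : Odd M)
    (hn : 5 ≤ n) (hM1 : M ≠ 1) (σ : K ≃ₐ[ℚ] K) (hσσ : σ * σ = 1) (hσ1 : σ ≠ 1)
    (hσc : σ ≠ (IsCMField.complexConj K).restrictScalars ℚ) :
    ∃ (Φ : CMType K) (φ : K →+* ℂ) (X : AbelianVariety ℂ) (ι : 𝓞 K →+* End X)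
      (ϑ : K →+* Module.End ℂ (complexBetti X.X 1)),
      IsPrimitive (ℂ ≃+* ℂ) Φ.1 φ ∧ ¬ IsNondegenerate Φ ∧ IsCMTypeRealisation Φ X ι ϑ ∧ X.IsSimple ∧
      X.dim = Module.finrank ℚ K / 2 ∧
      ∃ n p : ℕ, ∃ x : complexBetti (⨁ fun _ : Fin n => X).X (2 * p), IsRationalClass x ∧
        IsOfHodgeType (⨁ fun _ : Fin n => X).dim (⨁ fun _ : Fin n => X).X (2 * p) p p x ∧
        x ∉ divisorClassesSpan (⨁ fun _ : Fin n => X).X (⨁ fun _ : Fin n => X).dim p :=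
  exists_simple_degenerate_of_not_forall_isNondegenerate fun hgood =>
    hσc (involution_eq_complexConj_of_thirtytwo_dvd hdeg hM hn hM1 hgood σ hσσ hσ1)

/-- **`[K:ℚ] = 2ⁿ·p` (`p` an odd prime, `n ≥ 5`) and a Sylow `2`-subgroup neither cyclic nor generalised quaternion ⟹ BAD** (gen 38's
`exists_simple_degenerate_of_sylow_two_of_dvd` needed `n ≥ 6`). [cite: Shimura1998, §6.2 Thm. 3 and §8.2 Prop. 26]
[cite: Gordon1999HodgeAVSurvey, Thm. 6.4 and §9.3] [cite: Rotman1995, Thm. 5.46] -/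
theorem exists_simple_degenerate_of_sylow_two_of_thirtytwo_dvd {n p : ℕ} (hp : p.Prime) (hp2 : p ≠ 2)
    (hdeg : Module.finrank ℚ K = 2 ^ n * p) (hn : 5 ≤ n) [Fact (Nat.Prime 2)] (S : Sylow 2 (K ≃ₐ[ℚ] K))
    (hS : ¬ IsCyclic (S : Subgroup (K ≃ₐ[ℚ] K))) (hS' : IsEmpty ((S : Subgroup (K ≃ₐ[ℚ] K)) ≃* QuaternionGroup (2 ^ (n - 2)))) :
    ∃ (Φ : CMType K) (φ : K →+* ℂ) (X : AbelianVariety ℂ) (ι : 𝓞 K →+* End X)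
      (ϑ : K →+* Module.End ℂ (complexBetti X.X 1)),
      IsPrimitive (ℂ ≃+* ℂ) Φ.1 φ ∧ ¬ IsNondegenerate Φ ∧ IsCMTypeRealisation Φ X ι ϑ ∧ X.IsSimple ∧
      X.dim = Module.finrank ℚ K / 2 ∧
      ∃ n p : ℕ, ∃ x : complexBetti (⨁ fun _ : Fin n => X).X (2 * p), IsRationalClass x ∧
        IsOfHodgeType (⨁ fun _ : Fin n => X).dim (⨁ fun _ : Fin n => X).X (2 * p) p p x ∧
        x ∉ divisorClassesSpan (⨁ fun _ : Fin n => X).X (⨁ fun _ : Fin n => X).dim p :=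
  haveI : Fact p.Prime := ⟨hp⟩
  exists_simple_degenerate_of_not_forall_isNondegenerate fun hgood => by
    obtain ⟨P, hPn, hcardP⟩ := exists_normal_prime_of_thirtytwo_dvd hp2 hdeg hn hgood
    haveI := hPn
    rcases (sylow_two_isCyclic_or_quaternion_of_normal_prime hp2 hdeg hn P hcardP hgood S).2 with h | ⟨⟨f⟩⟩
    · exact hS h
    · exact hS'.false f

end Summit.HodgeConjecture.CorCM.GaloisModels

end
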